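import Summits.BirchSwinnertonDyer.BirchSwinnertonDyer.Theorems.SignedLowerHalvesKobayashiLowerHalfSemistablePW21NonEisensteinTwo
import Summits.BirchSwinnertonDyer.BirchSwinnertonDyer.Theorems.SignedLowerHalvesKobayashiLowerHalfSemistablePW21NonEisensteinOdd
import Literature.NumberTheory.EllipticCurves.NonEisensteinPrimeOfSurjective
import HarnessLib

/-!
# The mod-`p` Eisenstein criterion in the Brandt module at EVERY prime `p` (`p = 2, 3` included): non-congruent weighted
# coordinates, a degree-zero pairing unit, `p ∤ i_r`, Pollack–Weston's Lemma 2.1 — for `E[p]` IRREDUCIBLE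

Route-independent `Theorems` file (cell `b2b-bsdres`, seat `b2b-bsdres-x10b` = class owner X6/X7, gen 42); part 7 of the
series `…PW21CubeRoots` / `…PW21FixedIdeals` / `…DefmuPollackWestonLemma21` (gen 41) / `…PW21NonEisensteinOdd` /
`…PW21FourthRoots` / `…PW21NonEisensteinTwo` (gen 42).
HONEST FRAMING: prove what is provable now; shrink each hard class to its core with data; no claim beyond stated
classes. Nothing about any curve is asserted beyond the displayed hypotheses and NO summit statement is proved here;
BSD is not proved by any of this.

The Literature criterion (`BrandtEigenvectorNonEisenstein.lean`, `PollackWestonNonEisenstein.lean`) asks `5 ≤ p` and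
`ρ̄_{E,p}` surjective; part 4 gave every ODD `p` and irreducible; part 6 gave `p = 2`. Assembled here:

* `dvd_sub_prime_add_one_of_forall_dvd_prime`, `exists_not_dvd_weight_mul_sub_prime`,
  `exists_sum_eq_zero_not_dvd_pairing_prime` — for a Brandt setup of type `(N⁺, N⁻)`, `v ∈ L(λ)` with `p ∤ v_{c₀}`:
  `w_c v_c ≡ w_{c'} v_{c'} (mod p)` for all `c, c'` forces `λ(ℓ) ≡ ℓ + 1 (mod p)` at every prime `ℓ ∤ N⁺N⁻`, `ℓ ≠ p`;
  contrapositively one non-Eisenstein `λ(ℓ)` gives `c, c'` with `p ∤ w_c v_c - w_{c'} v_{c'}` and a degree-zero `y`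
  with `p ∤ ⟨v, y⟩`.
* `exists_not_dvd_weight_mul_sub_of_irreducible_anyPrime`, `exists_sum_eq_zero_not_dvd_pairing_of_irreducible_anyPrime`,
  `not_dvd_generator_range_pairing_of_irreducible_anyPrime`, `exists_not_dvd_weight_mul_of_irreducible_anyPrime` — the
  elliptic-curve readings for `λ = a(E)` and `ρ̄_{E,p}` IRREDUCIBLE at ANY prime `p`: in particular
  **`p ∤ i_r` for every prime `p` at which `E[p]` is irreducible** — the definite-side content of Takahashi 2001
  Thm. 2.7 (printed from Ribet 1990 Thm. 3.12, `r ≥ 5`) / Pollack–Weston Prop. 6.4 (1) (`p ≥ 5`, CR), here inside the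
  Brandt module for every `r` and every `p` — and Pollack–Weston's Lemma 2.1 at every prime.

## References

* [PollackWeston2011] R. Pollack, T. Weston, Compos. Math. 147 (2011), §2.1 Lemma 2.1, §6.2 Prop. 6.3–6.4, §6.3.
* [Takahashi2001] S. Takahashi, J. Number Theory 90 (2001), Lemma 2.2, Thm. 2.3, Thm. 2.7.
* [Ribet1990] K. Ribet, Invent. Math. 100 (1990), §3, Thm. 3.12.
* [DarmonDiamondTaylor1995] H. Darmon, F. Diamond, R. Taylor, *Fermat's Last Theorem* (1995), Prop. 2.6(b).
-/

noncomputable section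

open scoped BigOperators Matrix

-- D-0017: single-problem summit, the namespace repeats the problem name by design.
set_option linter.dupNamespace false

namespace Summit.BirchSwinnertonDyer.BirchSwinnertonDyer.Theorems.PollackWestonLemma21

section Setups

open Literature.NumberTheory.Automorphic Literature.NumberTheory.Automorphic.Brandt

variable {Nplus Nminus : ℕ}

/-! ### The criterion at every prime -/

/-- **Congruent weighted coordinates force Eisenstein eigenvalues — EVERY prime `p`.** Let `S` be a Brandt setup of type
`(N⁺, N⁻)`, `v ∈ L(λ)` with `p ∤ v_{c₀}`, and `w_c v_c ≡ w_{c'} v_{c'} (mod p)` for all `c, c'`. Then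
`λ(ℓ) ≡ ℓ + 1 (mod p)` for every prime `ℓ ∤ N⁺N⁻` with `ℓ ≠ p` (`p = 2`: `dvd_sub_prime_add_one_of_forall_dvd_two`;
`p` odd: part 4's `dvd_sub_prime_add_one_of_forall_dvd_odd`, where `ℓ ≠ p` is not even needed).
[cite: Ribet1990, §3 Thm. 3.12] [cite: PollackWeston2011, Prop. 6.3] -/
theorem dvd_sub_prime_add_one_of_forall_dvd_prime (S : XiSetup Nplus Nminus) [Fintype (ClassSet S.O)]
    {lam : ℕ → ℤ} {v : ClassSet S.O → ℤ} (hv : v ∈ eigenLattice (Nplus * Nminus) (matrix S.O) lam)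
    {p : ℕ} (hp : p.Prime) {c₀ : ClassSet S.O} (hv0 : ¬ (p : ℤ) ∣ v c₀)
    (hcong : ∀ c c', (p : ℤ) ∣ (weight S.O c : ℤ) * v c - (weight S.O c' : ℤ) * v c')
    {ℓ : ℕ} (hℓ : ℓ.Prime) (hℓp : ℓ ≠ p) (hℓN : ¬ ℓ ∣ Nplus * Nminus) :
    (p : ℤ) ∣ lam ℓ - (ℓ + 1) := by
  by_cases hp2 : p = 2
  · subst hp2
    exact dvd_sub_prime_add_one_of_forall_dvd_two S hv (by exact_mod_cast hv0)
      (fun c c' => by exact_mod_cast hcong c c') hℓ hℓp hℓN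
  · exact dvd_sub_prime_add_one_of_forall_dvd_odd S hv hp hp2 hv0 hcong hℓ hℓN

/-- **A non-Eisenstein eigenvalue produces non-congruent weighted coordinates — every prime `p`**: with `v ∈ L(λ)`,
`p ∤ v_{c₀}`, one prime `ℓ ∤ N⁺N⁻`, `ℓ ≠ p`, with `λ(ℓ) ≢ ℓ + 1 (mod p)` gives classes `c, c'` with
`p ∤ w_c v_c - w_{c'} v_{c'}`. [cite: Takahashi2001, Lemma 2.2] [cite: PollackWeston2011, Prop. 6.4 (1)] -/
theorem exists_not_dvd_weight_mul_sub_prime (S : XiSetup Nplus Nminus) [Fintype (ClassSet S.O)]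
    {lam : ℕ → ℤ} {v : ClassSet S.O → ℤ} (hv : v ∈ eigenLattice (Nplus * Nminus) (matrix S.O) lam)
    {p : ℕ} (hp : p.Prime) {c₀ : ClassSet S.O} (hv0 : ¬ (p : ℤ) ∣ v c₀)
    {ℓ : ℕ} (hℓ : ℓ.Prime) (hℓp : ℓ ≠ p) (hℓN : ¬ ℓ ∣ Nplus * Nminus) (hne : ¬ (p : ℤ) ∣ lam ℓ - (ℓ + 1)) :
    ∃ c c' : ClassSet S.O, ¬ (p : ℤ) ∣ (weight S.O c : ℤ) * v c - (weight S.O c' : ℤ) * v c' := by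
  by_contra h
  push Not at h
  exact hne (dvd_sub_prime_add_one_of_forall_dvd_prime S hv hp hv0 h hℓ hℓp hℓN)

/-- **Degree-zero form — every prime `p`**: under the hypotheses of `exists_not_dvd_weight_mul_sub_prime` there is a
degree-zero `y` (`Σ_c y_c = 0`) with `p ∤ ⟨v, y⟩ = Σ_c w_c v_c y_c`. [cite: Ribet1990, §3] [cite: Takahashi2001, Lemma 2.2] -/
theorem exists_sum_eq_zero_not_dvd_pairing_prime (S : XiSetup Nplus Nminus) [Fintype (ClassSet S.O)]
    [DecidableEq (ClassSet S.O)] {lam : ℕ → ℤ} {v : ClassSet S.O → ℤ}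
    (hv : v ∈ eigenLattice (Nplus * Nminus) (matrix S.O) lam)
    {p : ℕ} (hp : p.Prime) {c₀ : ClassSet S.O} (hv0 : ¬ (p : ℤ) ∣ v c₀)
    {ℓ : ℕ} (hℓ : ℓ.Prime) (hℓp : ℓ ≠ p) (hℓN : ¬ ℓ ∣ Nplus * Nminus) (hne : ¬ (p : ℤ) ∣ lam ℓ - (ℓ + 1)) :
    ∃ y : ClassSet S.O → ℤ, ∑ c, y c = 0 ∧ ¬ (p : ℤ) ∣ ∑ c, (weight S.O c : ℤ) * v c * y c := by
  obtain ⟨c, c', hcc'⟩ := exists_not_dvd_weight_mul_sub_prime S hv hp hv0 hℓ hℓp hℓN hne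
  have hne' : c ≠ c' := by
    rintro rfl
    exact hcc' (by rw [sub_self]; exact dvd_zero _)
  refine ⟨Pi.single c 1 - Pi.single c' 1, ?_, ?_⟩
  · simp only [Pi.sub_apply, Pi.single_apply, Finset.sum_sub_distrib, Finset.sum_ite_eq',
      Finset.mem_univ, if_true, sub_self]
  · simp only [Pi.sub_apply, Pi.single_apply, mul_sub, mul_ite, mul_one, mul_zero,
      Finset.sum_sub_distrib, Finset.sum_ite_eq', Finset.mem_univ, if_true]
    exact hcc'

end Setups

/-! ### Elliptic curves: `ρ̄_{E,p}` irreducible, ANY prime `p` -/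

section EllipticCurves

open Literature.NumberTheory.EllipticCurves Literature.NumberTheory.Automorphic.Brandt

variable {Nplus Nminus : ℕ}

/-- **`E[p]` irreducible ⇒ the `a(E)`-eigenvector is non-Eisenstein mod `p` — ANY prime `p`.** `E/ℚ` (model `W`) of
conductor `N_E = N⁺N⁻`, `S` a Brandt setup of type `(N⁺, N⁻)`, `p` a prime with `ρ̄_{E,p}` irreducible, `v` in the
`a(E)`-eigen-lattice with `p ∤ v_{c₀}`: then `p ∤ w_c v_c - w_{c'} v_{c'}` for some `c, c'` (a good prime `ℓ ≠ p`,
`ℓ ∤ N_E`, with `a_ℓ(E) ≢ ℓ + 1 (mod p)` from `exists_prime_not_dvd_lFunction_sub_of_hasIrreducibleModPGaloisRep`, then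
`exists_not_dvd_weight_mul_sub_prime`). [cite: PollackWeston2011, Prop. 6.3–6.4] [cite: DarmonDiamondTaylor1995, Prop. 2.6(b)] -/
theorem exists_not_dvd_weight_mul_sub_of_irreducible_anyPrime (W : WeierstrassCurve ℚ) [W.IsElliptic]
    (hN : W.conductorNorm ℤ = Nplus * Nminus) {p : ℕ} [Fact p.Prime]
    (hirr : W.HasIrreducibleModPGaloisRep p) (S : XiSetup Nplus Nminus) [Fintype (ClassSet S.O)]
    {v : ClassSet S.O → ℤ} (hv : v ∈ eigenLattice (Nplus * Nminus) (matrix S.O) fun n => W.LFunction n)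
    {c₀ : ClassSet S.O} (hv0 : ¬ (p : ℤ) ∣ v c₀) :
    ∃ c c' : ClassSet S.O, ¬ (p : ℤ) ∣ (weight S.O c : ℤ) * v c - (weight S.O c' : ℤ) * v c' := by
  obtain ⟨ℓ, hℓ, hℓp, hℓN, hne⟩ := exists_prime_not_dvd_lFunction_sub_of_hasIrreducibleModPGaloisRep W p hirr
  rw [hN] at hℓN
  exact exists_not_dvd_weight_mul_sub_prime S hv Fact.out hv0 hℓ hℓp (by exact_mod_cast hℓN) hne

/-- **Degree-zero form** for `E[p]` irreducible, any prime `p`: some `y ∈ ℤ[Cls O]⁰` has `p ∤ ⟨v, y⟩`.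
[cite: PollackWeston2011, Prop. 6.4 (1)] [cite: Ribet1990, §3] -/
theorem exists_sum_eq_zero_not_dvd_pairing_of_irreducible_anyPrime (W : WeierstrassCurve ℚ) [W.IsElliptic]
    (hN : W.conductorNorm ℤ = Nplus * Nminus) {p : ℕ} [Fact p.Prime]
    (hirr : W.HasIrreducibleModPGaloisRep p) (S : XiSetup Nplus Nminus) [Fintype (ClassSet S.O)]
    [DecidableEq (ClassSet S.O)] {v : ClassSet S.O → ℤ}
    (hv : v ∈ eigenLattice (Nplus * Nminus) (matrix S.O) fun n => W.LFunction n)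
    {c₀ : ClassSet S.O} (hv0 : ¬ (p : ℤ) ∣ v c₀) :
    ∃ y : ClassSet S.O → ℤ, ∑ c, y c = 0 ∧ ¬ (p : ℤ) ∣ ∑ c, (weight S.O c : ℤ) * v c * y c := by
  obtain ⟨ℓ, hℓ, hℓp, hℓN, hne⟩ := exists_prime_not_dvd_lFunction_sub_of_hasIrreducibleModPGaloisRep W p hirr
  rw [hN] at hℓN
  exact exists_sum_eq_zero_not_dvd_pairing_prime S hv Fact.out hv0 hℓ hℓp (by exact_mod_cast hℓN) hne

/-- **`p ∤ i_r` for EVERY prime `p` at which `E[p]` is irreducible** (the definite-side content of Takahashi 2001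
Thm. 2.7 / Pollack–Weston Prop. 6.4 (1), with no condition on `p` or on `r`). In a Brandt setup `S` of type `(N⁺, N⁻)`,
`N⁺N⁻ = N_E`, let `X ⊆ ℤ^{Cls O}` be a sublattice CONTAINING every degree-zero vector (e.g. the character group), `g` a
generator of the `a(E)`-eigen-line, and `i` an integer dividing every pairing `⟨g, y⟩ = Σ_c w_c g_c y_c`, `y ∈ X`. Then
`p ∤ i`. [cite: Takahashi2001, Lemma 2.2 and Thm. 2.7] [cite: PollackWeston2011, Prop. 6.4 (1)] -/
theorem not_dvd_generator_range_pairing_of_irreducible_anyPrime (W : WeierstrassCurve ℚ) [W.IsElliptic]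
    (hN : W.conductorNorm ℤ = Nplus * Nminus) {p : ℕ} [Fact p.Prime]
    (hirr : W.HasIrreducibleModPGaloisRep p) (S : XiSetup Nplus Nminus) [Fintype (ClassSet S.O)]
    (X : Submodule ℤ (ClassSet S.O → ℤ)) (hX0 : ∀ y : ClassSet S.O → ℤ, ∑ c, y c = 0 → y ∈ X)
    {g : ClassSet S.O → ℤ} (hg : g ≠ 0)
    (hL : eigenLattice (Nplus * Nminus) (matrix S.O) (fun n => W.LFunction n) = ℤ ∙ g) {i : ℤ}
    (hi : ∀ y ∈ X, i ∣ ∑ c, (weight S.O c : ℤ) * g c * y c) : ¬ (p : ℤ) ∣ i := by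
  classical
  obtain ⟨c₀, hc₀⟩ := exists_not_dvd_of_eigenLattice_eq_span hg hL (Fact.out : p.Prime)
  obtain ⟨y, hy0, hy⟩ := exists_sum_eq_zero_not_dvd_pairing_of_irreducible_anyPrime W hN hirr S
    (hL ▸ Submodule.mem_span_singleton_self g) hc₀
  exact fun hp => hy (dvd_trans hp (hi y (hX0 y hy0)))

/-- **Pollack–Weston Lemma 2.1 at EVERY prime `p` with `E[p]` irreducible** (`p = 2` included): for the generator `φ`
of the `a(E)`-eigen-line some `w_c φ_c` is prime to `p`. [cite: PollackWeston2011, §2.1 Lemma 2.1] -/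
theorem exists_not_dvd_weight_mul_of_irreducible_anyPrime (W : WeierstrassCurve ℚ) [W.IsElliptic]
    (hN : W.conductorNorm ℤ = Nplus * Nminus) {p : ℕ} [Fact p.Prime]
    (hirr : W.HasIrreducibleModPGaloisRep p) (S : XiSetup Nplus Nminus) [Fintype (ClassSet S.O)]
    {φ : ClassSet S.O → ℤ} (hφ0 : φ ≠ 0)
    (hφ : eigenLattice (Nplus * Nminus) (matrix S.O) (fun n => W.LFunction n) = ℤ ∙ φ) :
    ∃ c : ClassSet S.O, ¬ (p : ℤ) ∣ (weight S.O c : ℤ) * φ c := by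
  obtain ⟨c₀, hc₀⟩ := exists_not_dvd_of_eigenLattice_eq_span hφ0 hφ (Fact.out : p.Prime)
  obtain ⟨c, c', hcc'⟩ := exists_not_dvd_weight_mul_sub_of_irreducible_anyPrime W hN hirr S
    (hφ ▸ Submodule.mem_span_singleton_self φ) hc₀
  by_contra h
  push Not at h
  exact hcc' (dvd_sub (h c) (h c'))

end EllipticCurves

end Summit.BirchSwinnertonDyer.BirchSwinnertonDyer.Theorems.PollackWestonLemma21

end
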